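import Mathlib.Algebra.BigOperators.Group.Finset.Basic
import Mathlib.Algebra.Order.BigOperators.Group.Finset
import Mathlib.Data.Fintype.Fin
import Mathlib.Logic.Relation
import Mathlib.Logic.Function.Basic
import HarnessLib

/-!
# Coins and buckets (Hochman 2025, §3, Proposition 3.1)

The combinatorial game of §3 of M. Hochman, *Irreducibility and periodicity in `ℤ²` symbolic
systems* (Discrete Analysis 2025:17), which controls the "robust aperiodicity" of the witness sets
in the construction of a strongly irreducible aperiodic `ℤ²`-subshift (Thm. 1.1, vendored as the
named fact `Literature.Dynamics.SymbolicDynamics.Hochman2025_existsSIAperiodic`).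

*The game* (§3, p. 7–8). Finitely many coins, each showing *heads* or *tails*, lie in `k` buckets.
A *move* takes a coin of a chosen orientation out of a bucket and puts it into a bucket, where it
receives **the less common orientation among the coins already in the destination bucket** (free
choice on a tie). A bucket is *oriented* if all its coins show the same face, a configuration is
*oriented* if all buckets are, and *orientable* if some finite sequence of legal moves orients it.
`c_{k,n}` is the configuration with `n` coins in the first bucket, `⌊n/2⌋` heads and `⌈n/2⌉`
tails, all other buckets empty. Hochman shows that `c_{k,n}` is orientable for `n < 2^k`
(p. 8) and

* **Proposition 3.1.** *If `n ≥ 2^k` then `c_{k,n}` is unorientable.*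

*The modified game* (proof of Prop. 3.1, "A modified game", pp. 8–9): a *pile* is added; the only
moves are bucket → pile (a coin of a chosen, available orientation) and pile → bucket (the coin
receives the minority orientation of the destination, free on a tie); one starts with all `n`
coins on the pile and must end with an empty pile and oriented buckets. Every move of the original
game is a pair of moves of the modified game, and `c_{k,n}` is reached from the pile by `n`
insertions into the first bucket ("tails" on ties), so Prop. 3.1 follows from:

* `CoinsAndBuckets.not_isWon_of_reachable` — in the modified game with `n ≥ 2^k` coins, no
  position reachable from "everything on the pile" has an empty pile and all buckets oriented.

## The proof formalized here

Hochman's proof (pp. 8–11) rearranges an orienting sequence of moves bucket by bucket (peak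
states) and counts. We give instead a **potential-function proof** of the same statement, found
for this formalization (it is shorter to formalize and proves exactly the printed proposition): for
a set `R` of buckets put
`Φ_R = pile + ∑_{i ∉ R} (heads_i + tails_i) + ∑_{i ∈ R} min(heads_i, tails_i)`.
The family of inequalities `Φ_R ≥ 2^{k - |R|}` (all `R ⊆ {buckets}`) holds initially iff
`n ≥ 2^k` (take `R = ∅`), fails at every won position (take `R` = all buckets: `Φ = 0 < 1`), and
is preserved by every legal move: removals do not decrease any `Φ_R`; an insertion on the strict
minority side of bucket `i` leaves every `Φ_R` unchanged; an insertion into a TIED bucket `i`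
(`heads_i = tails_i = m`) decreases `Φ_R` by one exactly when `i ∈ R`, and in that case the
inequality for `R \ {i}` before the move, `pile + 2m + (rest) ≥ 2 · 2^{k-|R|}`, together with
`pile ≥ 1`, gives `Φ_R ≥ 2^{k-|R|} + 1` before the move (distinguish `m < 2^{k-|R|}` and
`m ≥ 2^{k-|R|}`). (Brute force confirms that `pile ≤ max_R (2^{k-|R|} - 1 - Φ_R + pile)` is in
fact the exact winning criterion for `k ≤ 3`, `n ≤ 11`; only the easy direction is needed and
proved.)

## Main statements

* `CoinsAndBuckets.Pos`, `CoinsAndBuckets.Step`, `CoinsAndBuckets.IsWon` — the modified game.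
* `CoinsAndBuckets.not_isWon_of_reachable` — the modified game cannot be won with `n ≥ 2^k` coins.
* `CoinsAndBuckets.Config`, `CoinsAndBuckets.Move`, `CoinsAndBuckets.ckn`,
  `CoinsAndBuckets.Hochman2025_prop_3_1` — **Prop. 3.1 as printed**: no sequence of moves of the
  original game leads from `c_{k,n}`, `n ≥ 2^k`, to an oriented configuration. (We allow the
  destination bucket to equal the source bucket, the minority being read after the removal; this
  only adds moves, so unorientability in our sense implies it in any stricter reading.)

## References

* [Hochman2025] M. Hochman, *Irreducibility and periodicity in `ℤ²` symbolic systems*, Discrete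
  Analysis 2025:17, §3 (pp. 7–11), Proposition 3.1. Read via `lit read arxiv:2401.02273`.
-/

open Finset

namespace Literature.Dynamics.SymbolicDynamics

namespace CoinsAndBuckets

/-! ### The modified game (with a pile) -/

/-- A position of the modified coins-and-buckets game (Hochman §3, "A modified game"): `pile`
coins on the pile and, for each of the `k` buckets `i`, `heads i` coins showing heads and
`tails i` coins showing tails in it. [cite: Hochman2025, §3 (A modified game)] -/
structure Pos (k : ℕ) where
  /-- number of coins on the pile -/
  pile : ℕ
  /-- number of heads in each bucket -/
  heads : Fin k → ℕ
  /-- number of tails in each bucket -/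
  tails : Fin k → ℕ

/-- The legal moves of the modified game: a coin of a chosen (available) orientation goes from
bucket `i` to the pile, or a coin goes from the (non-empty) pile to bucket `i`, where it must
receive the LESS COMMON orientation among the coins in `i` (either one on a tie): it may become
heads only if `heads i ≤ tails i`, tails only if `tails i ≤ heads i`.
[cite: Hochman2025, §3 (A modified game)] -/
inductive Step {k : ℕ} : Pos k → Pos k → Prop
  /-- bucket `i` → pile, a heads coin -/
  | removeHeads (s : Pos k) (i : Fin k) (h : 0 < s.heads i) :
      Step s ⟨s.pile + 1, Function.update s.heads i (s.heads i - 1), s.tails⟩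
  /-- bucket `i` → pile, a tails coin -/
  | removeTails (s : Pos k) (i : Fin k) (h : 0 < s.tails i) :
      Step s ⟨s.pile + 1, s.heads, Function.update s.tails i (s.tails i - 1)⟩
  /-- pile → bucket `i`, landing heads (heads is the minority, or a tie) -/
  | insertHeads (s : Pos k) (i : Fin k) (hp : 0 < s.pile) (hle : s.heads i ≤ s.tails i) :
      Step s ⟨s.pile - 1, Function.update s.heads i (s.heads i + 1), s.tails⟩
  /-- pile → bucket `i`, landing tails (tails is the minority, or a tie) -/
  | insertTails (s : Pos k) (i : Fin k) (hp : 0 < s.pile) (hle : s.tails i ≤ s.heads i) :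
      Step s ⟨s.pile - 1, s.heads, Function.update s.tails i (s.tails i + 1)⟩

/-- The initial position of the modified game: all `n` coins on the pile, `k` empty buckets.
[cite: Hochman2025, §3 (A modified game)] -/
def init (k n : ℕ) : Pos k := ⟨n, 0, 0⟩

/-- A bucket configuration is *oriented* if in every bucket all coins show the same face.
[cite: Hochman2025, §3] -/
def IsOriented {k : ℕ} (heads tails : Fin k → ℕ) : Prop :=
  ∀ i, heads i = 0 ∨ tails i = 0

/-- A position of the modified game is *won*: empty pile and oriented buckets ("The game ... must
end in an empty pile and oriented buckets"). [cite: Hochman2025, §3 (A modified game)] -/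
def IsWon {k : ℕ} (s : Pos k) : Prop :=
  s.pile = 0 ∧ IsOriented s.heads s.tails

/-! ### The potential -/

/-- The contribution of bucket `j` to the potential `Φ_R`: `min(heads, tails)` if `j ∈ R`
("retired" buckets, which only still have to shed their minority), `heads + tails` otherwise.
[folklore] -/
def term {k : ℕ} (R : Finset (Fin k)) (s : Pos k) (j : Fin k) : ℕ :=
  if j ∈ R then min (s.heads j) (s.tails j) else s.heads j + s.tails j

/-- The potential `Φ_R(s) = pile + ∑_{j ∉ R} (heads_j + tails_j) + ∑_{j ∈ R} min(heads_j, tails_j)`.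
[folklore] -/
def pot {k : ℕ} (R : Finset (Fin k)) (s : Pos k) : ℕ :=
  s.pile + ∑ j, term R s j

/-- The invariant: `Φ_R ≥ 2^{k - |R|}` for every set `R` of buckets. [folklore] -/
def Good {k : ℕ} (s : Pos k) : Prop :=
  ∀ R : Finset (Fin k), 2 ^ (k - R.card) ≤ pot R s

/-- Initially (`n` coins on the pile, empty buckets) the invariant holds iff `n ≥ 2^k`; we need
the "if". [folklore] -/
theorem good_init {k n : ℕ} (hn : 2 ^ k ≤ n) : Good (init k n) := by
  intro R
  have hpot : pot R (init k n) = n := by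
    simp [pot, term, init]
  rw [hpot]
  exact le_trans (Nat.pow_le_pow_right (by decide) (Nat.sub_le k R.card)) hn

/-- A won position violates the invariant (take `R` = all buckets: `Φ = 0 < 1 = 2^0`).
[folklore] -/
theorem not_good_of_isWon {k : ℕ} {s : Pos k} (h : IsWon s) : ¬ Good s := by
  intro hg
  have h1 := hg Finset.univ
  have hpot : pot Finset.univ s = 0 := by
    obtain ⟨hp, hor⟩ := h
    simp only [pot, term, Finset.mem_univ, if_true, hp, zero_add]
    refine Finset.sum_eq_zero fun j _ => ?_
    rcases hor j with hj | hj <;> simp [hj]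
  rw [hpot, Finset.card_univ, Fintype.card_fin, Nat.sub_self, pow_zero] at h1
  exact Nat.not_succ_le_zero 0 h1

/-- Splitting the potential at bucket `i`: `Φ_R(s) = pile + term_i + ∑_{j ≠ i} term_j`.
[folklore] -/
theorem pot_eq_add {k : ℕ} (R : Finset (Fin k)) (s : Pos k) (i : Fin k) :
    pot R s = s.pile + term R s i + ∑ j ∈ Finset.univ.erase i, term R s j := by
  rw [pot, add_assoc, Finset.add_sum_erase _ _ (Finset.mem_univ i)]

/-- The terms away from the bucket that moves do not change. [folklore] -/
theorem sum_erase_congr {k : ℕ} (R R' : Finset (Fin k)) (s s' : Pos k) (i : Fin k)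
    (hR : ∀ j, j ≠ i → (j ∈ R ↔ j ∈ R'))
    (hh : ∀ j, j ≠ i → s'.heads j = s.heads j) (ht : ∀ j, j ≠ i → s'.tails j = s.tails j) :
    ∑ j ∈ Finset.univ.erase i, term R' s' j = ∑ j ∈ Finset.univ.erase i, term R s j := by
  refine Finset.sum_congr rfl fun j hj => ?_
  have hji : j ≠ i := Finset.ne_of_mem_erase hj
  simp only [term, hh j hji, ht j hji]
  by_cases hjR : j ∈ R
  · simp [hjR, (hR j hji).1 hjR]
  · have : j ∉ R' := fun h' => hjR ((hR j hji).2 h')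
    simp [hjR, this]

/-- Removing a heads coin does not decrease any `Φ_R`. [folklore] -/
theorem Good.removeHeads {k : ℕ} {s : Pos k} (hg : Good s) (i : Fin k) :
    Good ⟨s.pile + 1, Function.update s.heads i (s.heads i - 1), s.tails⟩ := by
  intro R
  set s' : Pos k := ⟨s.pile + 1, Function.update s.heads i (s.heads i - 1), s.tails⟩ with hs'
  have key := hg R
  rw [pot_eq_add R s i] at key
  rw [pot_eq_add R s' i, sum_erase_congr R R s s' i (fun _ _ => Iff.rfl)
    (fun j hj => by simp [hs', Function.update_of_ne hj]) (fun _ _ => rfl)]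
  have hterm : term R s i ≤ term R s' i + 1 := by
    simp only [hs', term, Function.update_self]
    split_ifs <;> omega
  have hpile : s'.pile = s.pile + 1 := rfl
  omega

/-- Removing a tails coin does not decrease any `Φ_R`. [folklore] -/
theorem Good.removeTails {k : ℕ} {s : Pos k} (hg : Good s) (i : Fin k) :
    Good ⟨s.pile + 1, s.heads, Function.update s.tails i (s.tails i - 1)⟩ := by
  intro R
  set s' : Pos k := ⟨s.pile + 1, s.heads, Function.update s.tails i (s.tails i - 1)⟩ with hs'
  have key := hg R
  rw [pot_eq_add R s i] at key
  rw [pot_eq_add R s' i, sum_erase_congr R R s s' i (fun _ _ => Iff.rfl) (fun _ _ => rfl)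
    (fun j hj => by simp [hs', Function.update_of_ne hj])]
  have hterm : term R s i ≤ term R s' i + 1 := by
    simp only [hs', term, Function.update_self]
    split_ifs <;> omega
  have hpile : s'.pile = s.pile + 1 := rfl
  omega

/-- Inserting a coin as heads (legal: pile non-empty, `heads i ≤ tails i`) preserves the
invariant: unchanged `Φ_R` unless `i ∈ R` and the bucket was tied, in which case the inequality
for `R.erase i` before the move absorbs the loss of one. [folklore] -/
theorem Good.insertHeads {k : ℕ} {s : Pos k} (hg : Good s) (i : Fin k) (hp : 0 < s.pile)
    (hle : s.heads i ≤ s.tails i) :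
    Good ⟨s.pile - 1, Function.update s.heads i (s.heads i + 1), s.tails⟩ := by
  intro R
  set s' : Pos k := ⟨s.pile - 1, Function.update s.heads i (s.heads i + 1), s.tails⟩ with hs'
  have key := hg R
  rw [pot_eq_add R s i] at key
  rw [pot_eq_add R s' i, sum_erase_congr R R s s' i (fun _ _ => Iff.rfl)
    (fun j hj => by simp [hs', Function.update_of_ne hj]) (fun _ _ => rfl)]
  have hpile : s'.pile + 1 = s.pile := by
    show s.pile - 1 + 1 = s.pile
    omega
  by_cases hiR : i ∈ R
  · rcases Nat.lt_or_ge (s.heads i) (s.tails i) with hlt | hge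
    · -- strict minority: `min` goes up by one
      have hterm : term R s' i = term R s i + 1 := by
        simp only [hs', term, Function.update_self, hiR, if_true]
        omega
      omega
    · -- tie: use the inequality for `R.erase i` before the move
      have heq : s.heads i = s.tails i := le_antisymm hle hge
      have key' := hg (R.erase i)
      rw [pot_eq_add (R.erase i) s i, sum_erase_congr R (R.erase i) s s i
        (fun j hj => by simp [Finset.mem_erase, hj]) (fun _ _ => rfl) (fun _ _ => rfl)] at key'
      have hcard : k - (R.erase i).card = (k - R.card) + 1 := by
        rw [Finset.card_erase_of_mem hiR]
        have h1 : 1 ≤ R.card := Finset.card_pos.mpr ⟨i, hiR⟩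
        have h2 : R.card ≤ k := by simpa using Finset.card_le_univ R
        omega
      rw [hcard, pow_succ] at key'
      have ht1 : term (R.erase i) s i = s.heads i + s.tails i := by simp [term]
      have ht2 : term R s i = s.heads i := by simp [term, hiR, heq]
      have ht3 : term R s' i = s.heads i := by simp [hs', term, hiR, heq]
      rw [ht1] at key'
      rw [ht2] at key
      rw [ht3]
      -- with `P := 2 ^ (k - R.card)`: cases `heads i < P` and `heads i ≥ P`
      rcases Nat.lt_or_ge (s.heads i) (2 ^ (k - R.card)) with h1 | h1 <;> omega
  · have hterm : term R s' i = term R s i + 1 := by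
      simp only [hs', term, Function.update_self, hiR, if_false]
      omega
    omega

/-- Inserting a coin as tails (legal: pile non-empty, `tails i ≤ heads i`) preserves the
invariant (symmetric to `Good.insertHeads`). [folklore] -/
theorem Good.insertTails {k : ℕ} {s : Pos k} (hg : Good s) (i : Fin k) (hp : 0 < s.pile)
    (hle : s.tails i ≤ s.heads i) :
    Good ⟨s.pile - 1, s.heads, Function.update s.tails i (s.tails i + 1)⟩ := by
  intro R
  set s' : Pos k := ⟨s.pile - 1, s.heads, Function.update s.tails i (s.tails i + 1)⟩ with hs'
  have key := hg R
  rw [pot_eq_add R s i] at key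
  rw [pot_eq_add R s' i, sum_erase_congr R R s s' i (fun _ _ => Iff.rfl) (fun _ _ => rfl)
    (fun j hj => by simp [hs', Function.update_of_ne hj])]
  have hpile : s'.pile + 1 = s.pile := by
    show s.pile - 1 + 1 = s.pile
    omega
  by_cases hiR : i ∈ R
  · rcases Nat.lt_or_ge (s.tails i) (s.heads i) with hlt | hge
    · have hterm : term R s' i = term R s i + 1 := by
        simp only [hs', term, Function.update_self, hiR, if_true]
        omega
      omega
    · have heq : s.tails i = s.heads i := le_antisymm hle hge
      have key' := hg (R.erase i)
      rw [pot_eq_add (R.erase i) s i, sum_erase_congr R (R.erase i) s s i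
        (fun j hj => by simp [Finset.mem_erase, hj]) (fun _ _ => rfl) (fun _ _ => rfl)] at key'
      have hcard : k - (R.erase i).card = (k - R.card) + 1 := by
        rw [Finset.card_erase_of_mem hiR]
        have h1 : 1 ≤ R.card := Finset.card_pos.mpr ⟨i, hiR⟩
        have h2 : R.card ≤ k := by simpa using Finset.card_le_univ R
        omega
      rw [hcard, pow_succ] at key'
      have ht1 : term (R.erase i) s i = s.heads i + s.tails i := by simp [term]
      have ht2 : term R s i = s.tails i := by simp [term, hiR, heq]
      have ht3 : term R s' i = s.tails i := by simp [hs', term, hiR, heq]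
      rw [ht1] at key'
      rw [ht2] at key
      rw [ht3]
      rcases Nat.lt_or_ge (s.tails i) (2 ^ (k - R.card)) with h1 | h1 <;> omega
  · have hterm : term R s' i = term R s i + 1 := by
      simp only [hs', term, Function.update_self, hiR, if_false]
      omega
    omega

/-- **The invariant is preserved by every legal move.** [folklore] -/
theorem Good.step {k : ℕ} {s s' : Pos k} (hg : Good s) (hst : Step s s') : Good s' := by
  cases hst with
  | removeHeads i h => exact hg.removeHeads i
  | removeTails i h => exact hg.removeTails i
  | insertHeads i hp hle => exact hg.insertHeads i hp hle
  | insertTails i hp hle => exact hg.insertTails i hp hle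

/-- The invariant propagates along any finite sequence of legal moves. [folklore] -/
theorem Good.reachable {k : ℕ} {s s' : Pos k} (hg : Good s)
    (h : Relation.ReflTransGen Step s s') : Good s' := by
  induction h with
  | refl => exact hg
  | tail _ hst ih => exact ih.step hst

/-- **The modified game cannot be won with `n ≥ 2^k` coins** (Hochman, proof of Prop. 3.1,
pp. 8–11: "Our goal is still to show that `n ≤ 2^k - 1`"): no position reachable from
"all `n` coins on the pile, `k` empty buckets" has an empty pile and all buckets oriented.
[cite: Hochman2025, Prop 3.1 (proof, A modified game)] -/
theorem not_isWon_of_reachable {k n : ℕ} (hn : 2 ^ k ≤ n) {s : Pos k}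
    (h : Relation.ReflTransGen Step (init k n) s) : ¬ IsWon s :=
  fun hw => not_good_of_isWon hw ((good_init hn).reachable h)

/-! ### The original game and Proposition 3.1 as printed -/

/-- A coin-and-bucket configuration (no pile): heads and tails counts in each of `k` buckets.
[cite: Hochman2025, §3] -/
structure Config (k : ℕ) where
  /-- number of heads in each bucket -/
  heads : Fin k → ℕ
  /-- number of tails in each bucket -/
  tails : Fin k → ℕ

/-- The position of the modified game with empty pile and the given buckets. [folklore] -/
def Config.toPos {k : ℕ} (c : Config k) : Pos k := ⟨0, c.heads, c.tails⟩

/-- A *move* of the original game (Hochman §3): remove from bucket `i` a coin of a chosen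
orientation (which must be present — legality), and place it in bucket `j` with the less common
orientation among the coins then in `j` (free choice on a tie). We allow `j = i` (the minority
being read after the removal), which only enlarges the set of moves. [cite: Hochman2025, §3] -/
inductive Move {k : ℕ} : Config k → Config k → Prop
  /-- a heads coin leaves `i`; it lands in `j` as heads (heads the minority of `j`, or tie) -/
  | headsToHeads (c : Config k) (i j : Fin k) (h : 0 < c.heads i)
      (hle : Function.update c.heads i (c.heads i - 1) j ≤ c.tails j) :
      Move c ⟨Function.update (Function.update c.heads i (c.heads i - 1)) j
        (Function.update c.heads i (c.heads i - 1) j + 1), c.tails⟩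
  /-- a heads coin leaves `i`; it lands in `j` as tails -/
  | headsToTails (c : Config k) (i j : Fin k) (h : 0 < c.heads i)
      (hle : c.tails j ≤ Function.update c.heads i (c.heads i - 1) j) :
      Move c ⟨Function.update c.heads i (c.heads i - 1),
        Function.update c.tails j (c.tails j + 1)⟩
  /-- a tails coin leaves `i`; it lands in `j` as heads -/
  | tailsToHeads (c : Config k) (i j : Fin k) (h : 0 < c.tails i)
      (hle : c.heads j ≤ Function.update c.tails i (c.tails i - 1) j) :
      Move c ⟨Function.update c.heads j (c.heads j + 1),
        Function.update c.tails i (c.tails i - 1)⟩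
  /-- a tails coin leaves `i`; it lands in `j` as tails (tails the minority of `j`, or tie) -/
  | tailsToTails (c : Config k) (i j : Fin k) (h : 0 < c.tails i)
      (hle : Function.update c.tails i (c.tails i - 1) j ≤ c.heads j) :
      Move c ⟨c.heads, Function.update (Function.update c.tails i (c.tails i - 1)) j
        (Function.update c.tails i (c.tails i - 1) j + 1)⟩

/-- Every move of the original game is two moves of the modified game (bucket → pile → bucket).
[cite: Hochman2025, §3 (A modified game, item 2)] -/
theorem Move.toPos {k : ℕ} {c c' : Config k} (h : Move c c') :
    Relation.ReflTransGen Step c.toPos c'.toPos := by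
  cases h with
  | headsToHeads i j h hle =>
    refine Relation.ReflTransGen.tail (Relation.ReflTransGen.single (Step.removeHeads c.toPos i h))
      ?_
    exact Step.insertHeads ⟨0 + 1, _, _⟩ j Nat.one_pos hle
  | headsToTails i j h hle =>
    refine Relation.ReflTransGen.tail (Relation.ReflTransGen.single (Step.removeHeads c.toPos i h))
      ?_
    exact Step.insertTails ⟨0 + 1, _, _⟩ j Nat.one_pos hle
  | tailsToHeads i j h hle =>
    refine Relation.ReflTransGen.tail (Relation.ReflTransGen.single (Step.removeTails c.toPos i h))
      ?_
    exact Step.insertHeads ⟨0 + 1, _, _⟩ j Nat.one_pos hle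
  | tailsToTails i j h hle =>
    refine Relation.ReflTransGen.tail (Relation.ReflTransGen.single (Step.removeTails c.toPos i h))
      ?_
    exact Step.insertTails ⟨0 + 1, _, _⟩ j Nat.one_pos hle

/-- Sequences of moves of the original game are sequences of moves of the modified game.
[folklore] -/
theorem Move.toPos_reflTransGen {k : ℕ} {c c' : Config k} (h : Relation.ReflTransGen Move c c') :
    Relation.ReflTransGen Step c.toPos c'.toPos := by
  induction h with
  | refl => exact Relation.ReflTransGen.refl
  | tail _ hm ih => exact ih.trans hm.toPos

/-- Hochman's configuration `c_{k,n}` (`k ≥ 1` buckets): all buckets empty except the first,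
which holds `n` coins, `⌊n/2⌋` heads and `⌈n/2⌉ = n - ⌊n/2⌋` tails. [cite: Hochman2025, §3] -/
def ckn (k n : ℕ) (hk : 0 < k) : Config k :=
  ⟨Function.update 0 ⟨0, hk⟩ (n / 2), Function.update 0 ⟨0, hk⟩ (n - n / 2)⟩

/-- `c_{k,n}` is reached in the modified game from "everything on the pile" by `n` insertions
into the first bucket, choosing tails on ties (Hochman, item 1 of "A modified game"); more
generally with `p` coins left over on the pile. [cite: Hochman2025, §3 (A modified game, item 1)] -/
theorem reachable_ckn (k : ℕ) (hk : 0 < k) (n p : ℕ) :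
    Relation.ReflTransGen Step (init k (p + n))
      ⟨p, Function.update 0 ⟨0, hk⟩ (n / 2), Function.update 0 ⟨0, hk⟩ (n - n / 2)⟩ := by
  induction n generalizing p with
  | zero =>
    have : (⟨p, Function.update 0 ⟨0, hk⟩ (0 / 2), Function.update 0 ⟨0, hk⟩ (0 - 0 / 2)⟩ :
        Pos k) = init k (p + 0) := by
      simp [init]
    rw [this]
  | succ n ih =>
    have hprev := ih (p + 1)
    rw [show p + 1 + n = p + (n + 1) by omega] at hprev
    refine hprev.tail ?_
    set i : Fin k := ⟨0, hk⟩
    rcases Nat.mod_two_eq_zero_or_one n with hev | hodd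
    · -- tie: insert tails
      have h1 : (n + 1) / 2 = n / 2 := by omega
      have h2 : n + 1 - n / 2 = (n - n / 2) + 1 := by omega
      have hst := Step.insertTails ⟨p + 1, Function.update 0 i (n / 2),
        Function.update 0 i (n - n / 2)⟩ i (Nat.succ_pos p)
        (by simp only [Function.update_self]; omega)
      simp only [Function.update_self, Function.update_idem, Nat.add_sub_cancel] at hst
      rw [h1, h2]
      exact hst
    · -- heads is the minority: insert heads
      have h1 : (n + 1) / 2 = n / 2 + 1 := by omega
      have h2 : n + 1 - (n / 2 + 1) = n - n / 2 := by omega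
      have hst := Step.insertHeads ⟨p + 1, Function.update 0 i (n / 2),
        Function.update 0 i (n - n / 2)⟩ i (Nat.succ_pos p)
        (by simp only [Function.update_self]; omega)
      simp only [Function.update_self, Function.update_idem, Nat.add_sub_cancel] at hst
      rw [h1, h2]
      exact hst

/-- **Hochman 2025, Proposition 3.1**: *if `n ≥ 2^k` then `c_{k,n}` is unorientable* — no
finite sequence of legal moves of the coins-and-buckets game leads from `c_{k,n}` to an oriented
configuration. (Via the modified game: `c_{k,n}` is reachable from the pile, moves are pairs of
pile moves, and an oriented configuration would be a won position, contradicting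
`not_isWon_of_reachable`.) [cite: Hochman2025, Prop 3.1] -/
theorem Hochman2025_prop_3_1 {k n : ℕ} (hk : 0 < k) (hn : 2 ^ k ≤ n) {c : Config k}
    (h : Relation.ReflTransGen Move (ckn k n hk) c) : ¬ IsOriented c.heads c.tails := by
  intro hor
  have h0 : Relation.ReflTransGen Step (init k n) (ckn k n hk).toPos := by
    simpa [ckn, Config.toPos] using reachable_ckn k hk n 0
  exact not_isWon_of_reachable hn (h0.trans (Move.toPos_reflTransGen h)) ⟨rfl, hor⟩


/-! ### Unorientability from one well-mixed bucket

For the existence of compatible configurations with PRESCRIBED buckets (Lemma 5.8 with a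
realistic count of coins): it is enough that some bucket holds at least `2^k` heads and at least
`2^k` tails, whatever the other buckets contain — the potential inequalities `Φ_R ≥ 2^{k-|R|}`
then hold, and they are preserved by legal moves and fail at oriented configurations. -/

/-- A configuration one of whose buckets holds `≥ 2^k` heads and `≥ 2^k` tails satisfies the
potential inequalities. [folklore] -/
theorem good_of_big_bucket {k : ℕ} (c : Config k) (i : Fin k) (hH : 2 ^ k ≤ c.heads i)
    (hT : 2 ^ k ≤ c.tails i) : Good c.toPos := by
  intro R
  have hterm : 2 ^ k ≤ term R c.toPos i := by
    unfold term Config.toPos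
    split_ifs
    · exact le_min hH hT
    · exact le_trans hH (Nat.le_add_right _ _)
  have hsum : term R c.toPos i ≤ ∑ j, term R c.toPos j :=
    Finset.single_le_sum (fun j _ => Nat.zero_le _) (Finset.mem_univ i)
  have hpow : 2 ^ (k - R.card) ≤ 2 ^ k := Nat.pow_le_pow_right (by decide) (Nat.sub_le k R.card)
  have hpot : ∑ j, term R c.toPos j ≤ pot R c.toPos := by unfold pot; exact Nat.le_add_left _ _
  exact hpow.trans (hterm.trans (hsum.trans hpot))

/-- No sequence of moves leads from a configuration satisfying the potential inequalities to an
oriented one. [cite: Hochman2025, Prop 3.1 (proof)] -/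
theorem not_isOriented_of_good {k : ℕ} {c c' : Config k} (hg : Good c.toPos)
    (h : Relation.ReflTransGen Move c c') : ¬ IsOriented c'.heads c'.tails := fun hor =>
  not_good_of_isWon ⟨rfl, hor⟩ (hg.reachable (Move.toPos_reflTransGen h))

/-- **Unorientable configurations with prescribed buckets**: if some bucket holds `≥ 2^k` heads
and `≥ 2^k` tails, the configuration is unorientable (no legal sequence of moves orients it),
whatever the other buckets contain. With `N ≥ k · 2^{k+1}` coins distributed arbitrarily over
`k` buckets, some bucket holds `≥ 2^{k+1}` coins (pigeonhole), and showing half of them heads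
makes the configuration unorientable — this is how compatible symbols are chosen for a frame
whose witnesses (hence buckets) are already placed. [cite: Hochman2025, Prop 3.1 and Lemma 5.8] -/
theorem not_isOriented_of_big_bucket {k : ℕ} {c c' : Config k} (i : Fin k) (hH : 2 ^ k ≤ c.heads i)
    (hT : 2 ^ k ≤ c.tails i) (h : Relation.ReflTransGen Move c c') : ¬ IsOriented c'.heads c'.tails :=
  not_isOriented_of_good (good_of_big_bucket c i hH hT) h

end CoinsAndBuckets

end Literature.Dynamics.SymbolicDynamics
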